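import Summits.Ventures.CertifiedArithmetic.LowPrec.RoundEqualPrecision
import Summits.Ventures.CertifiedArithmetic.LowPrec.DoubleRoundingFMAEqualPrecision

/-!
# Double rounding of quotients at equal precision (THEOREM N-div-E)

HONEST FRAMING (venture CertifiedArithmetic / cell `pub-lowprec`): certified error envelopes and
provably optimal rounding/accumulation schemes for low-precision formats under stated cost models;
every table by two implementations; no hardware or vendor claims.

`DRDiv φ ψ` (`DoubleRoundingDivisionMatrix.lean`): ONE division of `φ`-data executed (correctly
rounded, saturating round-to-nearest-even, subnormals kept) in `ψ` and converted to `φ` equals the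
correctly rounded quotient of `φ`.  The named `13 × 13` matrix has `16` failing embedded cells
(`drDiv_named_iff`); `7` of them join two records of EQUAL precision (`m_ψ = m_φ`, the quantum of
`ψ` finer: e3m2 → e5m2 / binary8p3 / binary8p3f, e2m3 → e4m3 / binary8p4 / binary8p4f,
e5m2 → binary8p3f).  This file explains them by one record-generic law and shows where its slips
must sit.

* §1 THE BAND COROLLARY FOR NESTED EQUAL PRECISIONS (`toRat_roundNE_roundNE_of_manBits_eq_of_le`):
  `m_φ = m_ψ = m ≥ 1`, `quantum ψ ≤ quantum φ`, `M_φ ≤ M_ψ` (rationals) `⟹ fl_φ (fl_ψ x) = fl_φ x`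
  for EVERY rational with `|x| ≥ 2^m · quantum φ` (the band lemma of `RoundEqualPrecision.lean`
  below the top of `φ`, saturation above it).  Hence a slip of ANY operation between such records
  has its exact result strictly inside the subnormal range of `φ` (`abs_div_lt_of_drDiv_slip` for
  the quotient).
* §2 THE SLIP AT A SUBNORMAL MIDPOINT `v = (j + 1/2)·q_φ` OF `φ` (a full-significand value of
  `ψ`), from either side: `fl_ψ (v ± ε) = v` for `0 < 4ε < q_φ`, and ties-to-even sends `v` AWAY
  from `v ± ε` when `j` is even (`+`, `roundNE_roundNE_ne_half_add`) resp. odd (`-`, `…_sub`).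
* §3 THEOREM N-div-E (`not_drDiv_of_equal_precision`): `m_ψ = m_φ = m ≥ 1`, `L_ψ < L_φ`, and the
  data `a = 2^i`, `b = 3·2^t` quanta of `φ` with `2^i = 2^(m+1+t)·quantum φ` in range (plus `2^m`
  quanta of `φ` and `2^m·2^(L_φ-L_ψ)` quanta of `ψ` in range) `⟹ ¬ DRDiv φ ψ`:
  `a / b = (2^(m+1)/3)·q_φ = (j + 1/2 ± 1/6)·q_φ` with `j = ⌊2^(m+1)/3⌋`, the sign and the parity
  of `j` both decided by the parity of `m` (`2^(m+1) ≡ 2, 1 (mod 3)`, `j` even, odd) — always the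
  slipping side of §2.  No nesting of the ranges is needed (e4m3 → binary8p4 is an instance).
* §4 ON THE NAMED RECORDS the hypothesis (canonical `t = max (0, -(L_φ + m + 1))`, boolean test
  `drDivEqNegTest`) holds on exactly `10` cells: the `7` equal-precision failing embedded cells and
  `3` non-embedded ones; an embedded pair of equal precision double-rounds quotients correctly iff
  the quanta AGREE (`drDiv_named_equal_precision_iff`).

Two implementations: A = `code/enum/div_necessity_laws.py` (exact rationals: the witness family on
the named cells and on pseudo-records; every quotient slip between nested equal-precision records
lies below `2^m·q_φ`) → `certs/enum/DOUBLE-ROUNDING-DIV-NECESSITY.json`; B = the kernel (this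
file).  PLACEMENT — KNOWN in substance: double rounding through a register of equal precision and
wider exponent range is exact except at underflow (x87 precision control, Shudo–Muraoka 2000 §3.2,
lit key `paper:galaxy-pdf-6957003653025018000`); innocuous double rounding of quotients wants
`p₂ ≥ 2p₁` and an `emin` condition [Figueroa1995, §3; Roux2014, §2 and Table II].  NEW here only:
the record-generic necessity statement over this cell's saturating `MiniFloat` records (truncated
tops, fnuz records, no range nesting assumed).  No hardware or vendor claims.
-/

namespace Summit.Ventures.CertifiedArithmetic

open Literature.ComputerArithmetic.FloatingPoint
open Literature.ComputerArithmetic.FloatingPoint.Format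
open Literature.ComputerArithmetic.FloatingPoint.MiniFloat

/-! ## §1 Nested equal precisions: innocuous above the subnormal band of `φ` -/

/-- THE BAND COROLLARY FOR NESTED EQUAL PRECISIONS: `m_φ = m_ψ ≥ 1`, `quantum ψ ≤ quantum φ`
and `maxRat φ ≤ maxRat ψ` give `fl_φ (fl_ψ x) = fl_φ x` for every rational `|x| ≥ 2^m·quantum φ`
(on `[2^m q_φ, M_φ]` the two roundings agree by the band lemma; above `M_φ` both sides saturate
at `M_φ`, a value of `ψ`). [this packet; cite: Figueroa1995, §2] -/
theorem toRat_roundNE_roundNE_of_manBits_eq_of_le {φ ψ : Format} (hm : φ.manBits = ψ.manBits)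
    (h1 : 1 ≤ φ.manBits) (hq : ψ.qexp ≤ φ.qexp) (hM : φ.maxRat ≤ ψ.maxRat) {x : ℚ}
    (hlo : 2 ^ φ.manBits * φ.quantum ≤ |x|) :
    (roundNE φ (roundNE ψ x).toRat).toRat = (roundNE φ x).toRat := by
  have hqq := quantum_le_quantum_of_qexp_le hq
  have hloψ : 2 ^ ψ.manBits * ψ.quantum ≤ |x| :=
    le_trans (by rw [← hm]; exact mul_le_mul_of_nonneg_left hqq (by positivity)) hlo
  rcases le_or_gt |x| φ.maxRat with hφ | hφ
  · exact toRat_roundNE_roundNE_of_manBits_eq_band hm h1 hlo hloψ hφ (le_trans hφ hM)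
  · -- beyond the top of `φ`: both sides saturate at `maxRat φ`, itself a value of `ψ`
    obtain ⟨z, hz⟩ := exists_toRat_eq_of_abs_le hm.le hq (top φ)
      (by rw [toRat_top, abs_of_nonneg ((abs_nonneg _).trans (abs_toRat_le_maxRat (top φ)))]
          exact hM)
    rw [toRat_top] at hz
    have hpos : ∀ y : ℚ, φ.maxRat < y →
        (roundNE φ (roundNE ψ y).toRat).toRat = (roundNE φ y).toRat := by
      intro y hy
      have h2 : φ.maxRat ≤ (roundNE ψ y).toRat := by
        have := toRat_roundNE_mono (φ := ψ) hy.le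
        rwa [← hz, toRat_roundNE_toRat, hz] at this
      rw [toRat_roundNE_of_maxRat_le_pos h2, toRat_roundNE_of_maxRat_le_pos hy.le]
    rcases le_or_gt 0 x with h0 | h0
    · rw [abs_of_nonneg h0] at hφ; exact hpos x hφ
    · rw [abs_of_neg h0] at hφ
      have := hpos (-x) hφ
      rwa [toRat_roundNE_neg, toRat_roundNE_neg, toRat_roundNE_neg, neg_inj] at this

/-- COROLLARY FOR THE QUOTIENT: between nested records of equal precision `m ≥ 1` a double-rounding
slip of `a / b` has `|a / b| < 2^m · quantum φ` — the exact quotient lies strictly inside the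
subnormal range of `φ`. [this packet] -/
theorem abs_div_lt_of_drDiv_slip {φ ψ : Format} (hm : φ.manBits = ψ.manBits) (h1 : 1 ≤ φ.manBits)
    (hq : ψ.qexp ≤ φ.qexp) (hM : φ.maxRat ≤ ψ.maxRat) {a b : MiniFloat φ}
    (h : (roundNE φ (roundNE ψ (a.toRat / b.toRat)).toRat).toRat
      ≠ (roundNE φ (a.toRat / b.toRat)).toRat) :
    |a.toRat / b.toRat| < 2 ^ φ.manBits * φ.quantum := by
  by_contra hc
  exact h (toRat_roundNE_roundNE_of_manBits_eq_of_le hm h1 hq hM (not_lt.mp hc))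

/-! ## §2 The slip at a subnormal midpoint, from either side -/

/-- JUST BELOW A FULL-WIDTH VALUE THAT IS NOT A POWER OF TWO ROUNDS UP TO IT: for
`2^m < s < 2^(m+1)` and `s·2^e ≤ M_ψ`, `fl_ψ (s·2^e·q - δ) = s·2^e·q` whenever `0 ≤ 2δ < 2^e·q`
(the spacing of `ψ` below the value is `2^e` quanta as well). [folklore] -/
theorem toRat_roundNE_full_sub_small {ψ : Format} {s e : ℕ} (hs : 2 ^ ψ.manBits < s)
    (hs' : s < 2 ^ (ψ.manBits + 1)) (hu : s * 2 ^ e ≤ ψ.maxScaled) {δ : ℚ} (hδ0 : 0 ≤ δ)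
    (hδ : 2 * δ < 2 ^ e * ψ.quantum) :
    (roundNE ψ (((s * 2 ^ e : ℕ) : ℚ) * ψ.quantum - δ)).toRat
      = ((s * 2 ^ e : ℕ) : ℚ) * ψ.quantum := by
  have hq := ψ.quantum_pos
  obtain ⟨z, hz⟩ := exists_toRat_eq_natMul (representable_mul_pow hs' hu)
  set v := ((s * 2 ^ e : ℕ) : ℚ) * ψ.quantum with hv
  set x := v - δ with hx
  have hnear := roundNE_nearest (φ := ψ) x z
  rw [hz, show x - v = -δ by rw [hx]; ring, abs_neg, abs_of_nonneg hδ0] at hnear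
  have hhi : (roundNE ψ x).toRat ≤ v := by
    have := (abs_le.mp hnear).1; rw [hx] at this; linarith
  have hlo : v - 2 * δ ≤ (roundNE ψ x).toRat := by
    have := (abs_le.mp hnear).2; rw [hx] at this; linarith
  rcases eq_or_lt_of_le hhi with h | h
  · exact h
  · have hcast : (((s - 1) * 2 ^ e : ℕ) : ℚ) = (s : ℚ) * 2 ^ e - 2 ^ e := by
      rw [Nat.cast_mul, Nat.cast_sub (by omega : 1 ≤ s)]; push_cast; ring
    have h3 : (((s - 1) * 2 ^ e : ℕ) : ℚ) * ψ.quantum < (roundNE ψ x).toRat := by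
      rw [hcast]; rw [hv] at hlo; push_cast at hlo; nlinarith
    have hr0 : 0 ≤ (roundNE ψ x).toRat := by
      refine le_trans ?_ h3.le
      rw [hcast]
      have h1s : (1 : ℚ) ≤ s := by exact_mod_cast (show 1 ≤ s by omega)
      nlinarith [pow_pos (show (0 : ℚ) < 2 by norm_num) e]
    have hmag : (roundNE ψ x).toRat = ((roundNE ψ x).scaledMag : ℚ) * ψ.quantum := by
      rw [← abs_of_nonneg hr0, abs_toRat]
    have hlt : (roundNE ψ x).scaledMag < s * 2 ^ e := by
      rw [hmag, hv] at h
      exact_mod_cast lt_of_mul_lt_mul_right h hq.le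
    have hgt : (s - 1) * 2 ^ e < (roundNE ψ x).scaledMag := by
      rw [hmag] at h3
      exact_mod_cast lt_of_mul_lt_mul_right h3 hq.le
    have hge := le_of_representable_gt_full (s := s - 1) (by omega) (representable_scaledMag _) hgt
    rw [Nat.sub_add_cancel (by omega : 1 ≤ s)] at hge
    omega

/-- TIES-TO-EVEN AT A HALF-INTEGER, ODD LOWER NEIGHBOUR: for `m ≥ 1`, odd `j` with
`j + 1 < 2^(m+1)` and `j + 1 ≤ M_φ`, `fl_φ ((j + 1/2)·q) = (j + 1)·q`. [folklore] -/
theorem toRat_roundNE_half_of_odd {φ : Format} (h1 : 1 ≤ φ.manBits) {j : ℕ} (hj : Odd j)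
    (hj1 : j + 1 < 2 ^ (φ.manBits + 1)) (hju : j + 1 ≤ φ.maxScaled) :
    (roundNE φ (((2 * j + 1 : ℕ) : ℚ) / 2 * φ.quantum)).toRat = ((j + 1 : ℕ) : ℚ) * φ.quantum := by
  have hq := φ.quantum_pos
  obtain ⟨z1, hz1⟩ :=
    exists_toRat_eq_natMul (representable_of_lt_pow (φ := φ) (n := j + 1) hj1 hju)
  set x := ((2 * j + 1 : ℕ) : ℚ) / 2 * φ.quantum with hx
  have ex1 : x - z1.toRat = -(φ.quantum / 2) := by rw [hx, hz1]; push_cast; ring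
  have hnear := roundNE_nearest (φ := φ) x z1
  rw [ex1, abs_neg, abs_of_pos (half_pos hq)] at hnear
  obtain ⟨T, hT⟩ := exists_toRat_eq_int_mul (roundNE φ x)
  have hTj : T = j ∨ T = j + 1 := by
    rw [hT] at hnear
    have e1 : x - (T : ℚ) * φ.quantum = (((2 * j + 1 : ℕ) : ℚ) / 2 - T) * φ.quantum := by
      rw [hx]; ring
    rw [e1, abs_mul, abs_of_pos hq] at hnear
    have h' : |((2 * j + 1 : ℕ) : ℚ) / 2 - T| ≤ 1 / 2 := by
      by_contra hc; push Not at hc; nlinarith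
    rw [abs_le] at h'; push_cast at h'
    have hlo : (j : ℚ) ≤ T := by linarith [h'.2]
    have hhi : (T : ℚ) ≤ j + 1 := by linarith [h'.1]
    have hlo' : (j : ℤ) ≤ T := by exact_mod_cast hlo
    have hhi' : T ≤ (j : ℤ) + 1 := by exact_mod_cast hhi
    omega
  rcases hTj with rfl | rfl
  · exfalso
    have hr1 : (roundNE φ x).toRat = ((j : ℕ) : ℚ) * φ.quantum := by rw [hT]; push_cast; ring
    have hev : 2 ∣ (roundNE φ x).man := by
      refine roundNE_man_even_of_tie h1 (y := z1) ?_ ?_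
      · rw [ex1, hr1, show x - ((j : ℕ) : ℚ) * φ.quantum = φ.quantum / 2 by
          rw [hx]; push_cast; ring, abs_neg]
      · rw [hz1, hr1]; push_cast
        intro h; have := mul_right_cancel₀ hq.ne' h; linarith
    rw [two_dvd_man_iff h1, scaledMag_eq_of_toRat_eq hr1] at hev
    have h2 : 2 ∣ j := dvd_trans (Dvd.intro _ rfl) hev
    obtain ⟨c, hc⟩ := hj
    omega
  · rw [hT]; push_cast; ring

/-- THE SLIP FROM ABOVE: `quantum ψ < quantum φ`, `m_ψ = m_φ = m ≥ 1`; for an even `j` with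
`2^m ≤ 2j + 1 < 2^(m+1)`, `j + 1 ≤ M_φ` and the midpoint `v = (j + 1/2)·q_φ` in range of `ψ`
(`(2j+1)·2^(L_φ-L_ψ-1) ≤ M_ψ`), every rational `x = v + ε`, `0 < 4ε < q_φ`, double-rounds
wrongly: `fl_ψ x = v`, `fl_φ v = j·q_φ`, `fl_φ x = (j+1)·q_φ`. [this packet] -/
theorem roundNE_roundNE_ne_half_add {φ ψ : Format} (hq : ψ.qexp + 1 ≤ φ.qexp)
    (hm : ψ.manBits = φ.manBits) (h1 : 1 ≤ φ.manBits) {j : ℕ} (hj : Even j)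
    (hjlo : 2 ^ φ.manBits ≤ 2 * j + 1) (hjhi : 2 * j + 1 < 2 ^ (φ.manBits + 1))
    (hju : j + 1 ≤ φ.maxScaled)
    (hM : (2 * j + 1) * 2 ^ ((φ.qexp - ψ.qexp).toNat - 1) ≤ ψ.maxScaled)
    {ε : ℚ} (hε0 : 0 < ε) (hε : 4 * ε < φ.quantum) :
    (roundNE φ (roundNE ψ (((2 * j + 1 : ℕ) : ℚ) / 2 * φ.quantum + ε)).toRat).toRat
      ≠ (roundNE φ (((2 * j + 1 : ℕ) : ℚ) / 2 * φ.quantum + ε)).toRat := by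
  have hq0 := φ.quantum_pos
  obtain ⟨d, hd⟩ : ∃ d, (φ.qexp - ψ.qexp).toNat = d + 1 := ⟨(φ.qexp - ψ.qexp).toNat - 1, by omega⟩
  have hQ : φ.quantum = 2 ^ (d + 1) * ψ.quantum := by
    rw [← hd]; exact quantum_eq_two_pow_mul (by omega)
  rw [hd, Nat.add_sub_cancel] at hM
  have hv : ((2 * j + 1 : ℕ) : ℚ) / 2 * φ.quantum
      = (((2 * j + 1) * 2 ^ d : ℕ) : ℚ) * ψ.quantum := by
    rw [hQ, pow_succ]; push_cast; ring
  have hY : (roundNE ψ (((2 * j + 1 : ℕ) : ℚ) / 2 * φ.quantum + ε)).toRat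
      = ((2 * j + 1 : ℕ) : ℚ) / 2 * φ.quantum := by
    rw [hv]
    refine toRat_roundNE_full_add_small (by rw [hm]; exact hjlo) (by rw [hm]; exact hjhi) hM
      hε0.le ?_
    rw [hQ, pow_succ] at hε
    have h2 : (0 : ℚ) < 2 ^ d * ψ.quantum := mul_pos (pow_pos (by norm_num) d) ψ.quantum_pos
    nlinarith
  have hX1 := toRat_roundNE_half_of_even h1 hj (by omega) hju
  have hX2 : (roundNE φ (((2 * j + 1 : ℕ) : ℚ) / 2 * φ.quantum + ε)).toRat
      = ((j + 1 : ℕ) : ℚ) * φ.quantum := by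
    have e1 : ((2 * j + 1 : ℕ) : ℚ) / 2 * φ.quantum + ε
        = ((j + 1 : ℕ) : ℚ) * φ.quantum + (ε - φ.quantum / 2) := by
      push_cast; ring
    rw [e1]
    refine toRat_roundNE_natMul_add_small (representable_of_lt_pow (by omega) hju) ?_
    rw [abs_of_neg (by linarith)]
    linarith
  rw [hY, hX1, hX2]; push_cast
  intro h; have := mul_right_cancel₀ hq0.ne' h; linarith

/-- THE SLIP FROM BELOW: as `roundNE_roundNE_ne_half_add` with an ODD `j` and `x = v - ε`,
`0 < 4ε < q_φ`: `fl_ψ x = v`, `fl_φ v = (j+1)·q_φ`, `fl_φ x = j·q_φ`. [this packet] -/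
theorem roundNE_roundNE_ne_half_sub {φ ψ : Format} (hq : ψ.qexp + 1 ≤ φ.qexp)
    (hm : ψ.manBits = φ.manBits) (h1 : 1 ≤ φ.manBits) {j : ℕ} (hj : Odd j)
    (hjlo : 2 ^ φ.manBits < 2 * j + 1) (hjhi : 2 * j + 1 < 2 ^ (φ.manBits + 1))
    (hju : j + 1 ≤ φ.maxScaled)
    (hM : (2 * j + 1) * 2 ^ ((φ.qexp - ψ.qexp).toNat - 1) ≤ ψ.maxScaled)
    {ε : ℚ} (hε0 : 0 < ε) (hε : 4 * ε < φ.quantum) :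
    (roundNE φ (roundNE ψ (((2 * j + 1 : ℕ) : ℚ) / 2 * φ.quantum - ε)).toRat).toRat
      ≠ (roundNE φ (((2 * j + 1 : ℕ) : ℚ) / 2 * φ.quantum - ε)).toRat := by
  have hq0 := φ.quantum_pos
  obtain ⟨d, hd⟩ : ∃ d, (φ.qexp - ψ.qexp).toNat = d + 1 := ⟨(φ.qexp - ψ.qexp).toNat - 1, by omega⟩
  have hQ : φ.quantum = 2 ^ (d + 1) * ψ.quantum := by
    rw [← hd]; exact quantum_eq_two_pow_mul (by omega)
  rw [hd, Nat.add_sub_cancel] at hM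
  have hv : ((2 * j + 1 : ℕ) : ℚ) / 2 * φ.quantum
      = (((2 * j + 1) * 2 ^ d : ℕ) : ℚ) * ψ.quantum := by
    rw [hQ, pow_succ]; push_cast; ring
  have hY : (roundNE ψ (((2 * j + 1 : ℕ) : ℚ) / 2 * φ.quantum - ε)).toRat
      = ((2 * j + 1 : ℕ) : ℚ) / 2 * φ.quantum := by
    rw [hv]
    refine toRat_roundNE_full_sub_small (by rw [hm]; exact hjlo) (by rw [hm]; exact hjhi) hM
      hε0.le ?_
    rw [hQ, pow_succ] at hε
    have h2 : (0 : ℚ) < 2 ^ d * ψ.quantum := mul_pos (pow_pos (by norm_num) d) ψ.quantum_pos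
    nlinarith
  have hX1 := toRat_roundNE_half_of_odd h1 hj (by omega) hju
  have hX2 : (roundNE φ (((2 * j + 1 : ℕ) : ℚ) / 2 * φ.quantum - ε)).toRat
      = (j : ℚ) * φ.quantum := by
    have e1 : ((2 * j + 1 : ℕ) : ℚ) / 2 * φ.quantum - ε
        = ((j : ℕ) : ℚ) * φ.quantum + (φ.quantum / 2 - ε) := by
      push_cast; ring
    rw [e1]
    refine toRat_roundNE_natMul_add_small (representable_of_lt_pow (by omega) (by omega)) ?_
    rw [abs_of_pos (by linarith)]
    linarith
  rw [hY, hX1, hX2]; push_cast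
  intro h; have := mul_right_cancel₀ hq0.ne' h; linarith

/-! ## §3 THEOREM N-div-E -/

/-- Powers of two against the quantum: `(n : ℤ) = k + L_φ ⟹ 2^n = 2^k · quantum φ`. [folklore] -/
theorem two_pow_eq_two_pow_mul_quantum {φ : Format} {n k : ℕ} (h : (n : ℤ) = k + φ.qexp) :
    (2 : ℚ) ^ n = 2 ^ k * φ.quantum := by
  unfold Format.quantum
  rw [← zpow_natCast, h, zpow_add₀ (by norm_num : (2 : ℚ) ≠ 0), zpow_natCast]

/-- THEOREM N-div-E (equal precision: a finer quantum is never innocuous for division), for EVERY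
pair of format records: `m_ψ = m_φ = m ≥ 1`, `L_ψ < L_φ`, the data `a = 2^i` and `b = 3·2^t`
quanta of `φ` in range with `i = m + 1 + t + L_φ` (so `a / b = 2^(m+1)/3` quanta of `φ`), `2^m`
quanta of `φ` and `2^m·2^(L_φ - L_ψ)` quanta of `ψ` in range `⟹ ¬ DRDiv φ ψ`.  The quotient is
`(j + 1/2 + 1/6)·q_φ` with `j = (2^(m+1) - 2)/3` even when `m` is even, `(j + 1/2 - 1/6)·q_φ` with
`j = (2^(m+1) - 1)/3` odd when `m` is odd: a subnormal midpoint of `φ` approached from the side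
that ties-to-even leaves.  No nesting of the finite ranges is assumed.
[this packet; cite: Figueroa1995, §3; cite: Roux2014, §2] -/
theorem not_drDiv_of_equal_precision {φ ψ : Format} (hq : ψ.qexp + 1 ≤ φ.qexp)
    (hm : ψ.manBits = φ.manBits) (h1 : 1 ≤ φ.manBits) {i t : ℕ}
    (hi : (i : ℤ) = φ.manBits + 1 + t + φ.qexp) (ha : 2 ^ i ≤ φ.maxScaled)
    (hb : 3 * 2 ^ t ≤ φ.maxScaled) (hN : 2 ^ φ.manBits ≤ φ.maxScaled)
    (hMψ : 2 ^ φ.manBits * 2 ^ (φ.qexp - ψ.qexp).toNat ≤ ψ.maxScaled) : ¬ DRDiv φ ψ := by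
  intro hD
  have hq0 := φ.quantum_pos
  have hm2 : 2 ≤ 2 ^ φ.manBits := le_trans (by norm_num) (Nat.pow_le_pow_right (by norm_num) h1)
  have hpow : 2 ^ (φ.manBits + 1) = 2 * 2 ^ φ.manBits := pow_succ' 2 _
  have haR : φ.Representable (2 ^ i) := by
    simpa using representable_mul_pow (φ := φ) (k := 1) (j := i) (by omega) (by simpa using ha)
  obtain ⟨a, ha'⟩ := exists_toRat_eq_natMul haR
  obtain ⟨b, hb'⟩ :=
    exists_toRat_eq_natMul (representable_mul_pow (φ := φ) (k := 3) (j := t) (by omega) hb)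
  have hquot : a.toRat / b.toRat = (2 : ℚ) ^ (φ.manBits + 1) / 3 * φ.quantum := by
    rw [ha', hb']
    push_cast
    rw [two_pow_eq_two_pow_mul_quantum (k := φ.manBits + 1 + t) (by push_cast; omega), pow_add]
    field_simp
  -- the range of `ψ` holds every midpoint `(2j+1)/2·q_φ` with `2j + 1 ≤ 2^(m+1)`
  have hMψ' : ∀ j : ℕ, 2 * j + 1 ≤ 2 * 2 ^ φ.manBits →
      (2 * j + 1) * 2 ^ ((φ.qexp - ψ.qexp).toNat - 1) ≤ ψ.maxScaled := by
    intro j hj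
    obtain ⟨d, hd⟩ : ∃ d, (φ.qexp - ψ.qexp).toNat = d + 1 :=
      ⟨(φ.qexp - ψ.qexp).toNat - 1, by omega⟩
    rw [hd, Nat.add_sub_cancel]
    rw [hd, pow_succ] at hMψ
    calc (2 * j + 1) * 2 ^ d ≤ (2 * 2 ^ φ.manBits) * 2 ^ d := Nat.mul_le_mul_right _ hj
      _ = 2 ^ φ.manBits * (2 ^ d * 2) := by ring
      _ ≤ ψ.maxScaled := hMψ
  -- `2^(m+1) = 3j + r`, `r ∈ {1, 2}`
  obtain ⟨j, r, hjr, hr3⟩ : ∃ j r, 2 ^ (φ.manBits + 1) = 3 * j + r ∧ r < 3 :=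
    ⟨_, _, (Nat.div_add_mod _ 3).symm, Nat.mod_lt _ (by norm_num)⟩
  have hr0 : r ≠ 0 := by
    rintro rfl
    have h3 : 3 ∣ 2 ^ (φ.manBits + 1) := ⟨j, by omega⟩
    have := Nat.prime_three.dvd_of_dvd_pow h3
    omega
  have hcast : (2 : ℚ) ^ (φ.manBits + 1) = 3 * j + r := by exact_mod_cast hjr
  rcases (show r = 1 ∨ r = 2 by omega) with rfl | rfl
  · -- `m` odd: `j` odd, the quotient is `(j + 1/2 - 1/6)·q_φ`
    have hjo : Odd j := Nat.odd_iff.mpr (by omega)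
    have hx : a.toRat / b.toRat = ((2 * j + 1 : ℕ) : ℚ) / 2 * φ.quantum - φ.quantum / 6 := by
      rw [hquot, hcast]; push_cast; ring
    have hne := roundNE_roundNE_ne_half_sub hq hm h1 hjo (by omega) (by omega) (by omega)
      (hMψ' j (by omega)) (ε := φ.quantum / 6) (by positivity) (by linarith)
    rw [← hx] at hne
    exact hne (hD a b)
  · -- `m` even: `j` even, the quotient is `(j + 1/2 + 1/6)·q_φ`
    have hje : Even j := Nat.even_iff.mpr (by omega)
    have hx : a.toRat / b.toRat = ((2 * j + 1 : ℕ) : ℚ) / 2 * φ.quantum + φ.quantum / 6 := by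
      rw [hquot, hcast]; push_cast; ring
    have hne := roundNE_roundNE_ne_half_add hq hm h1 hje (by omega) (by omega) (by omega)
      (hMψ' j (by omega)) (ε := φ.quantum / 6) (by positivity) (by linarith)
    rw [← hx] at hne
    exact hne (hD a b)

/-! ## §4 The named records -/

/-- THE HYPOTHESIS OF THEOREM N-div-E AS A BOOLEAN TEST on parameter records, with the canonical
exponent `t = max (0, -(L_X + m + 1))` (the least `t` making `a = 2^(m+1+t)·quantum` quanta an
integer number of quanta). [this packet] -/
def drDivEqNegTest (X Y : Format) : Bool :=
  decide (Y.qexp + 1 ≤ X.qexp) && decide (Y.manBits = X.manBits) && decide (1 ≤ X.manBits) &&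
  decide (2 ^ (X.manBits + 1 + (-(X.qexp + X.manBits + 1)).toNat + X.qexp).toNat ≤ X.maxScaled) &&
  decide (3 * 2 ^ (-(X.qexp + X.manBits + 1)).toNat ≤ X.maxScaled) &&
  decide (2 ^ X.manBits ≤ X.maxScaled) &&
  decide (2 ^ X.manBits * 2 ^ (X.qexp - Y.qexp).toNat ≤ Y.maxScaled)

/-- SOUNDNESS OF THE TEST: `drDivEqNegTest X Y ⟹ ¬ DRDiv X Y` (THEOREM N-div-E at the canonical
exponent). [this packet] -/
theorem not_drDiv_of_eqNegTest {X Y : Format} (h : drDivEqNegTest X Y = true) : ¬ DRDiv X Y := by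
  simp only [drDivEqNegTest, Bool.and_eq_true, decide_eq_true_eq] at h
  obtain ⟨⟨⟨⟨⟨⟨hq, hm⟩, h1⟩, ha⟩, hb⟩, hN⟩, hM⟩ := h
  exact not_drDiv_of_equal_precision hq hm h1 (t := (-(X.qexp + X.manBits + 1)).toNat)
    (i := (X.manBits + 1 + (-(X.qexp + X.manBits + 1)).toNat + X.qexp).toNat) (by omega) ha hb hN hM

/-- ON THE NAMED `13 × 13` MATRIX the test holds on exactly `10` cells: the `7` equal-precision
failing embedded cells of `drDiv_named_iff` and `3` non-embedded pairs (e4m3 → binary8p4 /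
binary8p4f, e5m2 → binary8p3: finer quantum, smaller top). [this packet] -/
theorem drDivEqNeg_named_iff : ∀ X ∈ namedFormats, ∀ Y ∈ namedFormats,
    drDivEqNegTest X Y = true ↔
    (X, Y) ∈ [(E3M2, E5M2), (E3M2, Binary8p3), (E3M2, Binary8p3F), (E2M3, E4M3),
      (E2M3, Binary8p4), (E2M3, Binary8p4F), (E4M3, Binary8p4), (E4M3, Binary8p4F),
      (E5M2, Binary8p3), (E5M2, Binary8p3F)] := by
  decide +kernel

/-- THE `7` EQUAL-PRECISION EMBEDDED CELLS FAIL BY THE LAW (`∉ drDivPairs`, `embedsTest`, and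
`¬ DRDiv` by `not_drDiv_of_eqNegTest`): e3m2 → e5m2 / binary8p3 / binary8p3f
(`1/16 ÷ 3/8 = 1/6 ↦ 5/32 ↦ 1/8`, directly `3/16`), e2m3 → e4m3 / binary8p4 / binary8p4f
(`1/4 ÷ 3/8 = 2/3 ↦ 11/16 ↦ 3/4`, directly `5/8`), e5m2 → binary8p3f (`2^-16 ÷ 3/8`); the `3`
non-embedded cells of the test fail a fortiori (`embeds_of_drDiv_named`). [this packet] -/
theorem drDivEqNeg_cells : ∀ p ∈ [(E3M2, E5M2), (E3M2, Binary8p3), (E3M2, Binary8p3F),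
    (E2M3, E4M3), (E2M3, Binary8p4), (E2M3, Binary8p4F), (E5M2, Binary8p3F)],
    p ∉ drDivPairs ∧ embedsTest p.1 p.2 = true ∧ ¬ DRDiv p.1 p.2 := by
  intro p hp
  simp only [List.mem_cons, List.not_mem_nil, or_false] at hp
  rcases hp with rfl | rfl | rfl | rfl | rfl | rfl | rfl
  all_goals exact ⟨by decide +kernel, by decide +kernel, not_drDiv_of_eqNegTest (by decide +kernel)⟩

/-- THE TABULATED WITNESSES OF THE `7` CELLS SIT BELOW THE BAND, as §1 forces: each quotient
`a / b` of `drDivWitTable` on an equal-precision cell has `|a / b| < 2^m · quantum X`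
(`1/6 < 1/4`, `2/3 < 1`, `2^-16/(3/8) < 2^-14`). [this packet] -/
theorem drDivWit_equal_precision_below_band : ∀ w ∈ drDivWitTable,
    w.1.manBits = w.2.1.manBits →
    |w.2.2.1 / w.2.2.2| < 2 ^ w.1.manBits * w.1.quantum := by
  decide +kernel

/-- READING, on the named matrix: an embedded pair with EQUAL precision double-rounds quotients
correctly iff the quanta agree (the `13` diagonal cells and binary8p3 ⊆ binary8p3f,
binary8p4 ⊆ binary8p4f hold; the `7` pairs with a finer quantum fail). [this packet] -/
theorem drDiv_named_equal_precision_iff : ∀ X ∈ namedFormats, ∀ Y ∈ namedFormats,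
    embedsTest X Y = true → X.manBits = Y.manBits → (DRDiv X Y ↔ X.qexp = Y.qexp) := by
  intro X hX Y hY he hm
  rw [drDiv_named_iff hX hY]
  revert X Y
  decide +kernel

end Summit.Ventures.CertifiedArithmetic
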